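import Summits.BirchSwinnertonDyer.BirchSwinnertonDyer.Theorems.ErratumRoadFiveNonSurjCornerKolyJRedefinition
import Summits.BirchSwinnertonDyer.BirchSwinnertonDyer.Theorems.ClassRecordThreeEulerHalvesAtThreeJetchevMaxOfPerLevel
import HarnessLib

/-!
# Route `ClassRecordThree` ∕ `KolyvaginRoadThree` (rung K2@3), crux `EulerHalvesAtThree` (item stmt-BirchSwinnertonDyer-19109),
# registered stub `stub_jetchevMaxHLAtThree`: the display re-keyed «stub ⟸ {hfin, hswap, hlev}» — the S9 input (Kolyvagin's
# redefinition of `m_∞`, McCallum 1991 Prop. 5.2) produced by the KERNEL prime swap instead of the typed fact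
# (cell `bsd-stepL`, seat `bsd-stepL-corner-p1` g8, courtesy for tam3-p1; `--supports stmt-BirchSwinnertonDyer-19109`)

WHAT. tam3-p1's `Koly.jetchevMaxHLAtThree_of_perLevel` (p486881) reads the stub ⟸ {hK, hlev}; `hK` is discharged by citation
from `McCallum1991.prop52_exists_conductor_kolyvaginClass_order_eq` in `…WalkSupplyAtThree` (by-citation closure of record,
planner RULING 7 (E)). This file adds the KERNEL road for the same input: `hK` from this seat's frame-generic
`Koly.kolyvaginRedefinition_of_swap` (`…NonSurjCornerKolyJRedefinition.lean`: hfin = some admissible `(n, d)` has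
`ord₃(P_n) < M(n)` — `n = 1`, `y_K` of infinite order; hswap = the instantiated conclusion of the abstract prime swap
`JET.Section6.exists_deep_conductor_of_swap`, `…NonSurjCornerKolyJSwap.lean`, p505956). One theorem; CONDITIONAL on
hfin ∕ hswap ∕ hlev; the stub is NOT discharged; no item closes; BSD not advanced (T7).
References: [McCallumLMS1991] §5 Lemma 5.1, Prop. 5.2; [BurungaleEtAl2026] Prop. 2.2.1; [Jetchev2008] Thm. 1.4, Proof of Thm. 1.1.
-/

set_option autoImplicit false

noncomputable section

open scoped Classical NumberField

namespace Summit.BirchSwinnertonDyer.Rank1Residual.X11b.Three.Koly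

open WeierstrassCurve Literature.NumberTheory.EllipticCurves
  Literature.NumberTheory.EllipticCurves.ModularForms
  Literature.NumberTheory.EllipticCurves.Rank1Residual
  Summit.BirchSwinnertonDyer.Rank1Residual Summit.BirchSwinnertonDyer.Rank1Residual.X11b
  IsDedekindDomain NumberField

/-- **`stub_jetchevMaxHLAtThree` (19109 v4) ⟸ {hfin, hswap, hlev} at tam3-p1's J₃ frames** (`r_an = 1`, `3 ∥ N`,
`Surj W 3`, odd Heegner `d_K` with `L(E^{d_K},1) ≠ 0`, `β`, `3 ∤ Dt.c`) — courtesy twin of `jetchevMaxHLAtThree_of_perLevel`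
with its hK binder produced by `kolyvaginRedefinition_of_swap` (a kernel road for the S9 input, next to the by-citation
road through `McCallum1991.prop52_…`). CONDITIONAL; nothing booked. [cite: Jetchev2008, Thm. 1.4 (p. 812)]
[cite: McCallumLMS1991, §5 Prop. 5.2 (p. 304)] [cite: BurungaleEtAl2026, Prop. 2.2.1 (§2.2)] -/
theorem jetchevMaxHLAtThree_of_swap_of_perLevel
    (hfin : ∀ (W : WeierstrassCurve ℚ) [W.IsElliptic] [W.IsGloballyMinimal] [NeZero (W.conductorNorm ℤ)]
      (K : Type) [Field K] [NumberField K]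
      (Dt : ModularParametrizationData W (W.conductorNorm ℤ)) (β : ℤ) (ι : K →+* ℂ),
      W.analyticRank = 1 → W.HasMultiplicativeReductionAtPrime 3 → Surj W 3 →
      IsImaginaryQuadratic K → SatisfiesHeegnerHypothesis (W.conductorNorm ℤ) K →
      Odd (NumberField.discr K) → (W.quadraticTwist (NumberField.discr K : ℚ)).entireLFunction 1 ≠ 0 →
      (4 * (W.conductorNorm ℤ : ℤ)) ∣ β ^ 2 - NumberField.discr K → ¬ (3 : ℤ) ∣ Dt.c →
      ∃ (n : ℕ) (d : KolyvaginHeegnerData Dt β ι n), Squarefree n ∧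
        (∀ ℓ ∈ n.primeFactors, Zhang2014.IsKolyvaginPrime (W.conductorNorm ℤ) W K 3 ℓ) ∧
        divOrd d 3 < Zhang2014.levelIndex W 3 n)
    (hswap : ∀ (W : WeierstrassCurve ℚ) [W.IsElliptic] [W.IsGloballyMinimal] [NeZero (W.conductorNorm ℤ)]
      (K : Type) [Field K] [NumberField K]
      (Dt : ModularParametrizationData W (W.conductorNorm ℤ)) (β : ℤ) (ι : K →+* ℂ),
      W.analyticRank = 1 → W.HasMultiplicativeReductionAtPrime 3 → Surj W 3 →
      IsImaginaryQuadratic K → SatisfiesHeegnerHypothesis (W.conductorNorm ℤ) K →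
      Odd (NumberField.discr K) → (W.quadraticTwist (NumberField.discr K : ℚ)).entireLFunction 1 ≠ 0 →
      (4 * (W.conductorNorm ℤ : ℤ)) ∣ β ^ 2 - NumberField.discr K → ¬ (3 : ℤ) ∣ Dt.c →
      ∀ (M e : ℕ) (n : ℕ) (d : KolyvaginHeegnerData Dt β ι n), Squarefree n →
        (∀ ℓ ∈ n.primeFactors, Zhang2014.IsKolyvaginPrime (W.conductorNorm ℤ) W K 3 ℓ ∧
          M + 1 ≤ Zhang2014.kolyvaginIndex W 3 ℓ) →
        (∀ (n' : ℕ) (d' : KolyvaginHeegnerData Dt β ι n'), Squarefree n' →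
          (∀ ℓ ∈ n'.primeFactors, Zhang2014.IsKolyvaginPrime (W.conductorNorm ℤ) W K 3 ℓ ∧
            M + 1 ≤ Zhang2014.kolyvaginIndex W 3 ℓ) → PDiv d' 3 M) →
        ¬ PDiv d 3 (M + 1) →
        ∃ (n' : ℕ) (d' : KolyvaginHeegnerData Dt β ι n'), Squarefree n' ∧
          (∀ ℓ ∈ n'.primeFactors, Zhang2014.IsKolyvaginPrime (W.conductorNorm ℤ) W K 3 ℓ ∧
            e ≤ Zhang2014.kolyvaginIndex W 3 ℓ) ∧ ¬ PDiv d' 3 (M + 1))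
    (hlev : ∀ (W : WeierstrassCurve ℚ) [W.IsElliptic] [W.IsGloballyMinimal] [NeZero (W.conductorNorm ℤ)]
      (K : Type) [Field K] [NumberField K]
      (Dt : ModularParametrizationData W (W.conductorNorm ℤ)) (β : ℤ) (ι : K →+* ℂ),
      W.analyticRank = 1 → W.HasMultiplicativeReductionAtPrime 3 → Surj W 3 →
      IsImaginaryQuadratic K → SatisfiesHeegnerHypothesis (W.conductorNorm ℤ) K →
      Odd (NumberField.discr K) → (W.quadraticTwist (NumberField.discr K : ℚ)).entireLFunction 1 ≠ 0 →
      (4 * (W.conductorNorm ℤ : ℤ)) ∣ β ^ 2 - NumberField.discr K → ¬ (3 : ℤ) ∣ Dt.c →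
      ∀ (v : HeightOneSpectrum (𝓞 ℚ)) (k n : ℕ) (d : KolyvaginHeegnerData Dt β ι n), Squarefree n →
        (∀ ℓ ∈ n.primeFactors, Zhang2014.IsKolyvaginPrime (W.conductorNorm ℤ) W K 3 ℓ) →
        (if divOrd d 3 < Zhang2014.levelIndex W 3 n then divOrd d 3 else (⊤ : ℕ∞)) < (k : ℕ∞) →
        padicValNat 3 (W.tamagawaNumberAt v) ≤ k →
        (k : ℕ∞) + (if divOrd d 3 < Zhang2014.levelIndex W 3 n then divOrd d 3 else ⊤) ≤
          Zhang2014.levelIndex W 3 n →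
        (padicValNat 3 (W.tamagawaNumberAt v) : ℕ∞) ≤
          (if divOrd d 3 < Zhang2014.levelIndex W 3 n then divOrd d 3 else ⊤)) :
    ∀ (W : WeierstrassCurve ℚ) [W.IsElliptic] [W.IsGloballyMinimal] [NeZero (W.conductorNorm ℤ)]
      (K : Type) [Field K] [NumberField K]
      (Dt : ModularParametrizationData W (W.conductorNorm ℤ)) (β : ℤ) (ι : K →+* ℂ),
      W.analyticRank = 1 → W.HasMultiplicativeReductionAtPrime 3 → Surj W 3 →
      IsImaginaryQuadratic K → SatisfiesHeegnerHypothesis (W.conductorNorm ℤ) K →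
      Odd (NumberField.discr K) → (W.quadraticTwist (NumberField.discr K : ℚ)).entireLFunction 1 ≠ 0 →
      (4 * (W.conductorNorm ℤ : ℤ)) ∣ β ^ 2 - NumberField.discr K → ¬ (3 : ℤ) ∣ Dt.c →
      ∀ (v : HeightOneSpectrum (𝓞 ℚ)) (s : ℕ), s ≤ padicValNat 3 (W.tamagawaNumberAt v) →
        ∀ (n : ℕ) (d : KolyvaginHeegnerData Dt β ι n), Squarefree n →
          (∀ ℓ ∈ n.primeFactors, Zhang2014.IsKolyvaginPrime (W.conductorNorm ℤ) W K 3 ℓ ∧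
            s ≤ Zhang2014.kolyvaginIndex W 3 ℓ) → PDiv d 3 s :=
  jetchevMaxHLAtThree_of_perLevel
    (fun W _ _ _ K _ _ Dt β ι hr hmult hρ hK' hHN hodd hLt hβ hc =>
      kolyvaginRedefinition_of_swap 3
        (hfin W K Dt β ι hr hmult hρ hK' hHN hodd hLt hβ hc) (hswap W K Dt β ι hr hmult hρ hK' hHN hodd hLt hβ hc))
    hlev

end Summit.BirchSwinnertonDyer.Rank1Residual.X11b.Three.Koly

end
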